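import Literature.Topology.FourManifolds.TautFoliationsFencePush
import HarnessLib

/-!
# Paths in one plaque with the same end points are homotopic in the leaf space

Sibling of `TautFoliationsFencePush.lean` (`homotopic_refl_of_forall_mem_plaque`). A plaque of a
flow box of a `C⁰` codimension-one foliation with normed leaf model `B` is the homeomorphic
image of `B` under the plaque map, continuous into the leaf topology; so **two paths of the leaf
space with the same end points all of whose points lie on one plaque are homotopic with fixed
end points** (straight-line interpolation between them in the `B`-coordinate), and more
generally two such maps from any space agree up to a homotopy fixing the points where they
coincide (`homotopicRel_of_forall_mem_plaque`). This is the elementary piece of the plaque-wise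
homotopies identifying the image of a contour leaf of the coned fence collar with the lift of
the loop (NOTES of the fact seat, plan (d)).

* `Foliation.homotopic_of_forall_mem_plaque` (**proved**),
  `Foliation.homotopyOfPlaque` (**definition**: the interpolation, for pasting arguments) with
  its value lemmas (**proved**).

All statements are [folklore].
-/

noncomputable section

open Set Function
open scoped Topology unitInterval

namespace Literature.Topology.FourManifolds

namespace Foliation

variable {B : Type*} [NormedAddCommGroup B] [NormedSpace ℝ B] {M : Type*} [TopologicalSpace M] (F : Foliation B M)
variable {e : OpenPartialHomeomorph M (B × ℝ)} {t : ℝ}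

/-- **The straight-line interpolation in a plaque** between two points of the plaque, read in
the leaf space: `σ ↦ plaqueMap ((1 - σ) b₀ + σ b₁)`. [folklore] -/
def plaqueInterp (e : OpenPartialHomeomorph M (B × ℝ)) (t : ℝ) (z₀ z₁ : M) (s : ℝ) : F.LeafSpace :=
  F.leafPlaqueMap e t ((1 - s) • (e z₀).1 + s • (e z₁).1)

/-- At `s = 0` the interpolation is the first point. [folklore] -/
theorem plaqueInterp_zero {z₀ z₁ : M} (hz₀ : z₀ ∈ plaque e t) : F.plaqueInterp e t z₀ z₁ 0 = toLeafSpace z₀ := by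
  show F.leafPlaqueMap e t ((1 - (0 : ℝ)) • (e z₀).1 + (0 : ℝ) • (e z₁).1) = _
  rw [sub_zero, one_smul, zero_smul, add_zero]
  exact congrArg toLeafSpace (plaqueMap_fst_eq hz₀)

/-- At `s = 1` the interpolation is the second point. [folklore] -/
theorem plaqueInterp_one {z₀ z₁ : M} (hz₁ : z₁ ∈ plaque e t) : F.plaqueInterp e t z₀ z₁ 1 = toLeafSpace z₁ := by
  show F.leafPlaqueMap e t ((1 - (1 : ℝ)) • (e z₀).1 + (1 : ℝ) • (e z₁).1) = _
  rw [sub_self, zero_smul, one_smul, zero_add]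
  exact congrArg toLeafSpace (plaqueMap_fst_eq hz₁)

/-- The interpolation between a point and itself is constant. [folklore] -/
theorem plaqueInterp_self {z : M} (hz : z ∈ plaque e t) (s : ℝ) : F.plaqueInterp e t z z s = toLeafSpace z := by
  show F.leafPlaqueMap e t ((1 - s) • (e z).1 + s • (e z).1) = _
  rw [← add_smul, sub_add_cancel, one_smul]
  exact congrArg toLeafSpace (plaqueMap_fst_eq hz)

/-- The interpolation stays in the plaque. [folklore] -/
theorem ofLeafSpace_plaqueInterp_mem (he : e ∈ F.atlas) (z₀ z₁ : M) (s : ℝ) : ofLeafSpace (F.plaqueInterp e t z₀ z₁ s) ∈ plaque e t :=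
  F.plaqueMap_mem_plaque he t _

/-- **Joint continuity of the interpolation** in the two points (moving continuously in `M`
inside the source) and the parameter, into the leaf space. [folklore] -/
theorem continuous_plaqueInterp (he : e ∈ F.atlas) {X : Type*} [TopologicalSpace X] {f g : X → M} {σf : X → ℝ}
    (hf : Continuous f) (hg : Continuous g) (hσ : Continuous σf) (hfs : ∀ x, f x ∈ e.source) (hgs : ∀ x, g x ∈ e.source) :
    Continuous fun x ↦ F.plaqueInterp e t (f x) (g x) (σf x) := by
  unfold plaqueInterp
  refine (F.continuous_leafPlaqueMap he t).comp ?_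
  have hbf : Continuous fun x ↦ (e (f x)).1 := continuous_fst.comp (e.continuousOn.comp_continuous hf hfs)
  have hbg : Continuous fun x ↦ (e (g x)).1 := continuous_fst.comp (e.continuousOn.comp_continuous hg hgs)
  exact ((continuous_const.sub hσ).smul hbf).add (hσ.smul hbg)

/-- **Two paths of the leaf space in one plaque with the same end points are homotopic.**
[folklore] -/
theorem homotopic_of_forall_mem_plaque (he : e ∈ F.atlas) {p q : F.LeafSpace} (γ₀ γ₁ : Path p q)
    (h₀ : ∀ s, ofLeafSpace (γ₀ s) ∈ plaque e t) (h₁ : ∀ s, ofLeafSpace (γ₁ s) ∈ plaque e t) : γ₀.Homotopic γ₁ := by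
  have hc : Continuous fun x : I × I ↦ F.plaqueInterp e t (ofLeafSpace (γ₀ x.2)) (ofLeafSpace (γ₁ x.2)) (x.1 : ℝ) :=
    F.continuous_plaqueInterp he ((F.continuous_ofLeafSpace.comp γ₀.continuous).comp continuous_snd)
      ((F.continuous_ofLeafSpace.comp γ₁.continuous).comp continuous_snd) (continuous_subtype_val.comp continuous_fst)
      (fun x ↦ (h₀ x.2).1) (fun x ↦ (h₁ x.2).1)
  refine ⟨{ toFun := fun x ↦ F.plaqueInterp e t (ofLeafSpace (γ₀ x.2)) (ofLeafSpace (γ₁ x.2)) (x.1 : ℝ)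
            continuous_toFun := hc
            map_zero_left := fun s ↦ ?_
            map_one_left := fun s ↦ ?_
            prop' := fun r s hs ↦ ?_ }⟩
  · show F.plaqueInterp e t (ofLeafSpace (γ₀ s)) (ofLeafSpace (γ₁ s)) ((0 : I) : ℝ) = γ₀ s
    exact F.plaqueInterp_zero (h₀ s)
  · show F.plaqueInterp e t (ofLeafSpace (γ₀ s)) (ofLeafSpace (γ₁ s)) ((1 : I) : ℝ) = γ₁ s
    exact F.plaqueInterp_one (h₁ s)
  · show F.plaqueInterp e t (ofLeafSpace (γ₀ s)) (ofLeafSpace (γ₁ s)) (r : ℝ) = γ₀ s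
    have hs' : γ₁ s = γ₀ s := by
      rcases hs with rfl | rfl
      · rw [γ₀.source, γ₁.source]
      · rw [γ₀.target, γ₁.target]
    rw [hs']
    exact F.plaqueInterp_self (h₀ s) _

end Foliation

end Literature.Topology.FourManifolds
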